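import Summits.CriticalPhenomena.PercolationContinuityZ3.Theorems.Transplant.GrigorchukSectionsDefs
import HarnessLib

/-!
# The first Grigorchuk group acts by PREFIX-PRESERVING maps and is LEVEL-TRANSITIVE from every base ray; every orbit meets every cylinder in infinitely many
# points

builds on p205010 (kernel theorem, internal audit signed; external expert review pending) — nothing in this file uses p205010; pure group theory, no percolation
statement, no node touched.  Group theory of `𝔊` (Grigorchuk 1980) on the level-one sections of «GrigorchukSectionsDefs» p590401: file O10a of the design owner's
scope record (`run/shared/lean/prim/bschramm/P3-NILPOTENT.md` §28; lead g25 GO 2026-08-28 01:09Z), used by «GrigorchukLamplighterFCScope» (FC(Γ₂) = 1).  Lane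
`prim-bschramm`, seat `prim-bschramm-p3` gen 35 (DESIGN OWNER).  Helper file (`--supports stmt-CriticalPhenomena-4575 --as helper`).  Def-free.  NOTHING about growth.
* §1 `apply_agree`: elements of `𝔊` preserve prefixes — if `x, y` agree on the letters `< n` so do `g x, g y` (tree automorphisms; induction on `n` through the sections,
  which stay in `𝔊`).
* §2 `exists_sec_eq`: each section map `sec j : St_𝔊(1) → 𝔊` is SURJECTIVE (`a = (aba)₁ = b₀`, `b = d₁ = (ada)₀`, `c = b₁ = (aba)₀`, `d = c₁ = (aca)₀`).
* §3 `exists_apply_agree`: LEVEL-TRANSITIVITY from any base ray — for all rays `y, x` and `n` some `g ∈ 𝔊` has `g y` agreeing with `x` on the letters `< n`.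
* §4 `exists_orbit_seq`: for all `y, z, n` an injective sequence of points of the orbit `𝔊 y` all agreeing with `z` below `n` — every orbit meets every cylinder
  in infinitely many points (in particular the orbit `X = 𝔊ρ` is infinite).
[cite: Grigorchuk1980, the group acts on the binary tree by automorphisms, transitively on every level] [cite: BartholdiErschler2012, §3.1 (ψ, St(1), the orbit X of ρ)]
-/

noncomputable section

namespace Summit.CriticalPhenomena.PercolationContinuityZ3.Theorems.Transplant

namespace Grigorchuk

/-! ## §1 Elements of `𝔊` preserve prefixes -/

/-- An element of `𝔊` lies in `St(1)` or differs from one by `a` on the right. [cite: BartholdiErschler2012, §3.1 ([𝔊 : St(1)] = 2)] -/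
theorem mem_stabOne_or {g : Equiv.Perm Ray} (hg : g ∈ grigorchukGroup) :
    (g ∈ stabOne ∧ g ∈ grigorchukGroup) ∨ (g * genA ∈ stabOne ∧ g * genA ∈ grigorchukGroup) := by
  have hK : Subgroup.closure stabOneGens = stabOne ⊓ grigorchukGroup := stabOne_inf_grigorchukGroup.symm
  rcases mem_closure_stabOneGens_or hg with h | h
  · rw [hK] at h; exact Or.inl h
  · rw [hK] at h; exact Or.inr h

/-- `a` preserves agreement of prefixes (it flips the first letter of both rays). [cite: Grigorchuk1980, definition of a] -/
theorem genA_agree {n : ℕ} {x y : Ray} (h : ∀ i < n, x i = y i) : ∀ i < n, genA x i = genA y i := by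
  intro i hi
  cases i with
  | zero => rw [genA_apply_zero, genA_apply_zero, h 0 hi]
  | succ j => rw [genA_apply, genA_apply, flipAt_apply_ne (by omega), flipAt_apply_ne (by omega), h _ hi]

/-- **Elements of `𝔊` preserve prefixes**: if `x` and `y` agree on the letters `< n`, so do `g x` and `g y`. [cite: Grigorchuk1980, the group acts on the binary
tree by automorphisms] -/
theorem apply_agree : ∀ (n : ℕ) {g : Equiv.Perm Ray}, g ∈ grigorchukGroup → ∀ {x y : Ray}, (∀ i < n, x i = y i) → ∀ i < n, g x i = g y i := by
  intro n
  induction n with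
  | zero => intro g _ x y _ i hi; omega
  | succ n ih =>
    -- first for elements of `St_𝔊(1)`, through the sections
    have key : ∀ (G : ↥stabOne), (G : Equiv.Perm Ray) ∈ grigorchukGroup → ∀ {x y : Ray}, (∀ i < n + 1, x i = y i) →
        ∀ i < n + 1, (G : Equiv.Perm Ray) x i = (G : Equiv.Perm Ray) y i := by
      intro G hG x y hxy
      have h0 : x 0 = y 0 := hxy 0 (by omega)
      have ht : ∀ i < n, tail x i = tail y i := fun i hi => hxy (i + 1) (by omega)
      rw [← cons_head_tail x, ← cons_head_tail y, apply_cons, apply_cons, h0]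
      have hs := ih (sec_mem_grigorchukGroup G hG (y 0)) ht
      intro i hi
      cases i with
      | zero => rfl
      | succ j => rw [cons_succ, cons_succ]; exact hs j (by omega)
    intro g hg x y hxy
    rcases mem_stabOne_or hg with ⟨h1, h2⟩ | ⟨h1, h2⟩
    · exact key ⟨g, h1⟩ h2 hxy
    · have e : g = (g * genA) * genA := by rw [mul_assoc, genA_mul_self, mul_one]
      rw [e, Equiv.Perm.mul_apply, Equiv.Perm.mul_apply]
      exact key ⟨g * genA, h1⟩ h2 (genA_agree hxy)
where
  /-- `a² = 1` (local). [cite: Grigorchuk1980, a is an involution] -/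
  genA_mul_self : genA * genA = 1 := Equiv.ext fun x => flipAt_involutive 0 x

/-! ## §2 The section maps are surjective onto `𝔊` -/

/-- **`sec j : St_𝔊(1) → 𝔊` is surjective** for both `j`. [cite: Grigorchuk1980, relations b = (a,c), c = (a,d), d = (1,b)]
[cite: BartholdiErschler2012, §3.1 (ψ(St(1)) projects onto G in each coordinate)] -/
theorem exists_sec_eq (j : Bool) {g : Equiv.Perm Ray} (hg : g ∈ grigorchukGroup) :
    ∃ G : ↥stabOne, (G : Equiv.Perm Ray) ∈ grigorchukGroup ∧ sec j G = g := by
  have ha : genA ∈ grigorchukGroup := Subgroup.subset_closure (by simp)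
  have hb : genB ∈ grigorchukGroup := Subgroup.subset_closure (by simp)
  have hc : genC ∈ grigorchukGroup := Subgroup.subset_closure (by simp)
  have hd : genD ∈ grigorchukGroup := Subgroup.subset_closure (by simp)
  have hconj : ∀ {k : Equiv.Perm Ray}, k ∈ grigorchukGroup → genA * k * genA ∈ grigorchukGroup := fun hk =>
    grigorchukGroup.mul_mem (grigorchukGroup.mul_mem ha hk) ha
  induction hg using Subgroup.closure_induction with
  | mem x hx =>
    simp only [Set.mem_insert_iff, Set.mem_singleton_iff] at hx
    rcases hx with rfl | rfl | rfl | rfl <;> cases j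
    · exact ⟨bSt, hb, sec_bSt.1⟩
    · exact ⟨⟨genA * bSt * genA, conj_genA_mem_stabOne bSt.2⟩, hconj hb, by rw [sec_conj_genA]; exact sec_bSt.1⟩
    · exact ⟨⟨genA * dSt * genA, conj_genA_mem_stabOne dSt.2⟩, hconj hd, by rw [sec_conj_genA]; exact sec_dSt.2⟩
    · exact ⟨dSt, hd, sec_dSt.2⟩
    · exact ⟨⟨genA * bSt * genA, conj_genA_mem_stabOne bSt.2⟩, hconj hb, by rw [sec_conj_genA]; exact sec_bSt.2⟩
    · exact ⟨bSt, hb, sec_bSt.2⟩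
    · exact ⟨⟨genA * cSt * genA, conj_genA_mem_stabOne cSt.2⟩, hconj hc, by rw [sec_conj_genA]; exact sec_cSt.2⟩
    · exact ⟨cSt, hc, sec_cSt.2⟩
  | one => exact ⟨1, grigorchukGroup.one_mem, map_one _⟩
  | mul x y _ _ ihx ihy =>
    obtain ⟨G, hG, hGx⟩ := ihx
    obtain ⟨H, hH, hHy⟩ := ihy
    exact ⟨G * H, grigorchukGroup.mul_mem hG hH, by rw [map_mul, hGx, hHy]⟩
  | inv x _ ihx =>
    obtain ⟨G, hG, hGx⟩ := ihx
    exact ⟨G⁻¹, grigorchukGroup.inv_mem hG, by rw [map_inv, hGx]⟩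

/-! ## §3 Level-transitivity from any base ray -/

/-- **LEVEL-TRANSITIVITY**: for all rays `y, x` and every `n`, some `g ∈ 𝔊` moves `y` to a ray agreeing with `x` on the letters `< n`.
[cite: Grigorchuk1980, the group acts transitively on every level of the tree] -/
theorem exists_apply_agree : ∀ (n : ℕ) (y x : Ray), ∃ g : Equiv.Perm Ray, g ∈ grigorchukGroup ∧ ∀ i < n, g y i = x i := by
  intro n
  induction n with
  | zero => intro y x; exact ⟨1, grigorchukGroup.one_mem, fun i hi => by omega⟩
  | succ n ih =>
    intro y x
    obtain ⟨g', hg', hagree⟩ := ih (tail y) (tail x)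
    obtain ⟨G, hG, hsec⟩ := exists_sec_eq (y 0) hg'
    have hGy : (G : Equiv.Perm Ray) y = cons (y 0) (g' (tail y)) := by
      conv_lhs => rw [← cons_head_tail y]
      rw [apply_cons, hsec]
    by_cases h0 : x 0 = y 0
    · refine ⟨G, hG, fun i hi => ?_⟩
      rw [hGy]
      cases i with
      | zero => exact h0.symm
      | succ j => rw [cons_succ]; exact hagree j (by omega)
    · refine ⟨genA * G, grigorchukGroup.mul_mem (Subgroup.subset_closure (by simp)) hG, fun i hi => ?_⟩
      rw [Equiv.Perm.mul_apply, hGy, genA_cons]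
      cases i with
      | zero => rw [cons_zero]; cases hx : x 0 <;> cases hy : y 0 <;> simp_all
      | succ j => rw [cons_succ]; exact hagree j (by omega)

/-! ## §4 Every orbit meets every cylinder in infinitely many points -/

/-- **Infinitely many orbit points in every cylinder**: for all rays `y, z` and `n` there is an INJECTIVE sequence of points of the orbit `𝔊 y`, all agreeing with
`z` on the letters `< n` (the `m`-th point continues with `1^m 0`).  In particular every orbit of `𝔊` on the boundary — e.g. `X = 𝔊ρ` — is infinite.
[cite: Grigorchuk1980, level-transitivity] [cite: BartholdiErschler2012, §3.1 (the orbit X of ρ)] -/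
theorem exists_orbit_seq (y z : Ray) (n : ℕ) :
    ∃ r : ℕ → Ray, Function.Injective r ∧ ∀ m, (∃ g : Equiv.Perm Ray, g ∈ grigorchukGroup ∧ g y = r m) ∧ ∀ i < n, r m i = z i := by
  -- the target prefixes: `z` below `n`, then `1^m 0`
  let w : ℕ → Ray := fun m i => if i < n then z i else !decide (i = n + m)
  have hw : ∀ m, ∃ g : Equiv.Perm Ray, g ∈ grigorchukGroup ∧ ∀ i < n + m + 1, g y i = w m i := fun m => exists_apply_agree (n + m + 1) y (w m)
  choose g hg hgw using hw
  refine ⟨fun m => g m y, ?_, fun m => ⟨⟨g m, hg m, rfl⟩, fun i hi => ?_⟩⟩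
  · intro m m' hmm'
    simp only at hmm'
    by_contra hne
    -- compare the letter `n + min m m'`
    have h1 : g m y (n + m) = false := by rw [hgw m (n + m) (by omega)]; simp [w]
    have h2 : g m' y (n + m') = false := by rw [hgw m' (n + m') (by omega)]; simp [w]
    rcases Nat.lt_or_gt_of_ne hne with hlt | hlt
    · have h3 : g m' y (n + m) = true := by rw [hgw m' (n + m) (by omega)]; simp [w]; omega
      have := congrFun hmm' (n + m)
      rw [h1, h3] at this
      exact Bool.false_ne_true this
    · have h3 : g m y (n + m') = true := by rw [hgw m (n + m') (by omega)]; simp [w]; omega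
      have := congrFun hmm' (n + m')
      rw [h3, h2] at this
      exact Bool.false_ne_true this.symm
  · show g m y i = z i
    rw [hgw m i (by omega)]; simp [w, hi]

end Grigorchuk

end Summit.CriticalPhenomena.PercolationContinuityZ3.Theorems.Transplant

end
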